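import Summits.QuantumFields.YangMills.Theorems.UnitScaleTiltFluctuationComparisonRegPrGlobalSlackCanonicalPolymersCoreSizes
import Summits.QuantumFields.YangMills.Theorems.UnitScaleTiltFluctuationComparisonRegPrGlobalSlackCanonicalEndToEndC
import Summits.QuantumFields.YangMills.Theorems.UnitScaleTiltFluctuationComparisonRegPrRepAtHeightsChiV3Fam
import HarnessLib

/-!
# `UnitScaleTiltFluctuationComparisonRegPrGlobalSlackCanonicalEndToEndChi` — STUB 3⁗χ OF v5kC FROM THE SIX CHART ROWS AT THE χ-RECORD'S CANONICAL POLYMERISATION, BY NAME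
# (crux `FluctuationComparisonRegPrIntL`, stmt-QuantumFields-20520, skeleton v5kC (OWNER ym3-torus-plan g23 C3 pen `birth_v5kC.lean` 3aa24e4fa8fcb956, R-57χ ADD. 6 token map
# `OfV3At ↦ OfV3ChiAt`, `PkgAtV3 ↦ PkgAtV3Chi`, `dataOfV3 ↦ dataOfV3chi`), STUB 3⁗χ `stub_globalTwoRunSlackFamChi`; width-lever lane B «(R1) print's χ of [Balaban1985UV3] (47) back»,
# seat ym-ust-19935-r1 g4; core port 4/5)

THE POINT.  Lane A's capstones `K1aChartRowsC/K ⟹ ⟨3⁗⟩` (`…CanonicalEndToEndC`, p545118) are stated over the old package `PkgAtV3` and its datum `dataOfV3 p (canonPolymer p)`; the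
registered successor 3⁗χ reads the χ-package `PkgAtV3Chi` and `dataOfV3chi p π ≡ dataOfCoreV3 (fun K ↦ (p K).toCore) π`.  With the canonical polymerisation and its five
producer rows now stated over the data core (`…CanonicalPolymersCore`, `…CoreRows`, `…CoreSizes`), the same composition reaches 3⁗χ:

* §1 **`K1aChartRowsCChi L 𝔠 a₀ a₁ a`** — `K1aChartRowsC` with the ADD. 6 token map applied (`OfV3ChiAt`, `PkgAtV3Chi`, rows at `dataOfV3chi p (canonPolymerCore (toCore ∘ p))` /
  `canonPTCore (toCore ∘ p)`): letters `0 < κ ≤ 𝔠.κ`, `κ₀(32,6) ≤ κ`, NO letter on `M₁`; **`K1aChartRowsKChi`** — the same at the record's own decay `κ := 𝔠.κ` (NO letter on the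
  record at all); `k1aChartRowsCChi_of_KChi`;
* §2 **`globalTwoRunSlackFamChi_of_k1aChartRowsCChi`** : `(∀ odd L ≥ 7, ∀ 𝔠 a₀ a₁ …, ∃ a ∈ (0,1), K1aChartRowsCChi L 𝔠 a₀ a₁ a) →` ⟨THE TEXT OF `stub_globalTwoRunSlackFamChi`
  VERBATIM⟩ — threshold `γB ⊓ gammaW ⊓ e^{2(1−p₀)}`, `π := canonPolymerCore (toCore ∘ p)`, `σ := 7`; producer rows `pintDecompTrivT_canonCore`, `locCover_canonCore`,
  `locBlockVolumeC_canonCore` (weight `volWeight L M₁`), `locMatched_canonCore`, `termSizeTrivT_canonCore`; windows `window_sum_le_one`/`window_jet`/`window_oldSlice`;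
  composition `globalTwoRunSlackTail_of_chartsC` (datum-generic); **`globalTwoRunSlackFamChi_of_k1aChartRowsKChi`**;
* §3 **`K1aLineChi`** (the ELEVEN rows at `dataOfV3chi p π` for a free polymer parameter / term function, lane A's `K1aLine` under the token map) and
  **`globalTwoRunSlackFamChi_of_k1aLineChi`** (`GlobalSlackKernelMatching.globalTwoRunSlackTail_of_charts` at the χ-datum) — for producers that do not use the canonical
  polymerisation.
So the registered 3⁗χ is, BY NAME, the six chart rows of the K1a interface at the χ-record's canonical polymerisation (K1a `FlatKernelCauchyΦ` — the unprinted two-run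
number comparison —, `TaylorSplitΦ`, `KernelSizeΦ`, `RemainderSmallΦ`, `CfgSizeΦ`, `CfgCauchyΦ (ℓ ≡ 1)`), exactly as 3⁗ was lane A's `K1aChartRowsK`.  Every `def` is a
hypothesis schema; nothing of [Balaban1985UV3]/[King1986] is asserted; no numerics; registry untouched.

References: C. King, CMP 102 (1986) 649–677 [King1986] (Thm 3.4 (3.9) p.656, Prop. 3.6 p.662); T. Bałaban, CMP 102 (1985) 255–275 [Balaban1985UV3] ((7) p.257, (24)–(25) p.262,
(28)–(30) p.263, (33)–(34) p.264, (43)–(47) pp.266–267, (57)–(61) pp.270–271); CMP 109 (1987) 249–301 [Balaban1987RG1] ((0.1) p.251, (0.26) p.257, (0.30) p.258).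
-/

set_option autoImplicit false

noncomputable section

namespace Summit.QuantumFields.YangMills.Theorems.GlobalSlackCanonicalPolymers

open scoped BigOperators
open Literature.MathematicalPhysics.QuantumFieldTheory.Balaban1983to89
open Literature.MathematicalPhysics.QuantumFieldTheory.Balaban1983to89.T3ContinuumYM3Torus
open Literature.MathematicalPhysics.QuantumFieldTheory.Balaban1983to89.T3UnitScaleTilt (θBal)
open Literature.MathematicalPhysics.QuantumFieldTheory.Balaban1983to89.T3AlphaInputsAC
open Literature.MathematicalPhysics.QuantumFieldTheory.Balaban1983to89.T3AlphaPolymerSocket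
open Literature.MathematicalPhysics.QuantumFieldTheory.Balaban1983to89.T3AlphaInputsACTwoRun
open Literature.MathematicalPhysics.QuantumFieldTheory.Balaban1983to89.T3AlphaInputsACTwoRunLevel
open Literature.MathematicalPhysics.QuantumFieldTheory.Balaban1983to89.B12TreeDecay (kappa₀ K₀ K₀_pos kappa₀_nonneg)
open Literature.MathematicalPhysics.QuantumFieldTheory.Balaban1985CMP102
open Literature.MathematicalPhysics.QuantumFieldTheory.Balaban1985CMP102.Setting
open Summit.QuantumFields.Balaban3D.Carriers
open Summit.QuantumFields.Balaban3D.Proofs.Primitives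
open Summit.QuantumFields.Balaban3D.Proofs.GroupModelLieC (lieC)
open Summit.QuantumFields.YangMills.Theorems
open Summit.QuantumFields.YangMills.Theorems.GlobalSlack (GlobalSupRateTSlack)
open Summit.QuantumFields.YangMills.Theorems.GlobalSlackKernelMatching
open Summit.QuantumFields.YangMills.Theorems.GlobalSlackLocalToGlobalCount (LocBlockVolumeC)

/-! ## §1 The six chart rows at the χ-record's canonical polymerisation -/

/-- **THE K1a CHART ROWS AT THE χ-RECORD'S CANONICAL POLYMERISATION** (hypothesis schema, never asserted) — lane A's `K1aChartRowsC` under the R-57χ token map: the located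
letters `0 < κ ≤ 𝔠.κ`, `κ₀(32,6) ≤ κ`, nonnegative constants, a threshold, and for every family / coupling / inhabited χ-package (`OfV3ChiAt`) a coherent family
`p : ∀ K, PkgAtV3Chi …` with the given [7]-constants and ONE chart family over `↥(lieC (suGroupModel 2))` with the SIX CHART ROWS at the χ-datum
`dataOfV3chi p (canonPolymerCore (toCore ∘ p))` / `canonPTCore (toCore ∘ p)`: `TaylorSplitΦ`, K1a `FlatKernelCauchyΦ`, `KernelSizeΦ`, `RemainderSmallΦ`, `CfgSizeΦ`,
`CfgCauchyΦ (ℓ ≡ 1)`.  NO letter on `M₁`. [cite: Balaban1985UV3, (25) p.262, (28)-(30) p.263, (33)-(34) p.264, (43)-(47) pp.266-267; King1986, Thm 3.4 (3.9) p.656, Prop. 3.6 (3.56) p.662] -/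
def K1aChartRowsCChi (L : ℕ) (𝔠 : AlphaConsts L (suGroupModel 2).N) (a₀ a₁ a : ℝ) : Prop :=
  ∃ (κ C C_E C_R C_s C_B γB : ℝ), 0 < κ ∧ κ ≤ 𝔠.κ ∧ kappa₀ (4 * 2 ^ 3) (2 * 3) ≤ κ ∧ 0 ≤ C ∧ 0 ≤ C_E ∧ 0 ≤ C_R ∧ 0 ≤ C_s ∧ 0 ≤ C_B ∧ 0 < γB ∧
    ∀ (F : T3Family) (γ : ℝ) (hF : F.L = L) (hγ : 0 < γ), γ ≤ γB → ∀ (hγ1 : γ ≤ (min (hF ▸ 𝔠).gamma0 1) ^ 2),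
      AlphaInputsT3AC.OfV3ChiAt F (hF ▸ 𝔠) a₀ a₁ →
        ∃ (p : ∀ K, AlphaInputsT3AC.PkgAtV3Chi F (hF ▸ 𝔠) γ hγ hγ1 K), (∀ K, (p K).a₀ = a₀ ∧ (p K).a₁ = a₁) ∧
          ∃ (Φ : ChartFam ↥(lieC (suGroupModel 2)) F) (e : VacFam F) (B : CfgFam ↥(lieC (suGroupModel 2)) F) (R : RemFam F),
            TaylorSplitΦ (canonPTCore fun K => (p K).toCore) Φ e B R ∧
            FlatKernelCauchyΦ (AlphaInputsT3AC.dataOfV3chi p (canonPolymerCore fun K => (p K).toCore)) Φ κ a C ∧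
            KernelSizeΦ (AlphaInputsT3AC.dataOfV3chi p (canonPolymerCore fun K => (p K).toCore)) Φ κ C_E ∧
            RemainderSmallΦ (AlphaInputsT3AC.dataOfV3chi p (canonPolymerCore fun K => (p K).toCore)) R (hF ▸ 𝔠).b₀ (hF ▸ 𝔠).p₀ κ C_R ∧
            CfgSizeΦ (AlphaInputsT3AC.dataOfV3chi p (canonPolymerCore fun K => (p K).toCore)) B (hF ▸ 𝔠).b₀ (hF ▸ 𝔠).p₀ C_s ∧
            CfgCauchyΦ (AlphaInputsT3AC.dataOfV3chi p (canonPolymerCore fun K => (p K).toCore)) B (hF ▸ 𝔠).b₀ (hF ▸ 𝔠).p₀ a C_B fun _ => 1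

/-- **THE K1a CHART ROWS AT THE χ-RECORD'S CANONICAL POLYMERISATION AT THE RECORD'S DECAY RATE `κ := 𝔠.κ`** (hypothesis schema, never asserted) — lane A's `K1aChartRowsK`
under the R-57χ token map: NO condition on the constants record at all (`AlphaConsts.kappa_ge`). [cite: Balaban1985UV3, (25) p.262, (28)-(30) p.263, (33)-(34) p.264, (43)-(47) pp.266-267; King1986, Thm 3.4 (3.9) p.656, Prop. 3.6 (3.56) p.662] -/
def K1aChartRowsKChi (L : ℕ) (𝔠 : AlphaConsts L (suGroupModel 2).N) (a₀ a₁ a : ℝ) : Prop :=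
  ∃ (C C_E C_R C_s C_B γB : ℝ), 0 ≤ C ∧ 0 ≤ C_E ∧ 0 ≤ C_R ∧ 0 ≤ C_s ∧ 0 ≤ C_B ∧ 0 < γB ∧
    ∀ (F : T3Family) (γ : ℝ) (hF : F.L = L) (hγ : 0 < γ), γ ≤ γB → ∀ (hγ1 : γ ≤ (min (hF ▸ 𝔠).gamma0 1) ^ 2),
      AlphaInputsT3AC.OfV3ChiAt F (hF ▸ 𝔠) a₀ a₁ →
        ∃ (p : ∀ K, AlphaInputsT3AC.PkgAtV3Chi F (hF ▸ 𝔠) γ hγ hγ1 K), (∀ K, (p K).a₀ = a₀ ∧ (p K).a₁ = a₁) ∧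
          ∃ (Φ : ChartFam ↥(lieC (suGroupModel 2)) F) (e : VacFam F) (B : CfgFam ↥(lieC (suGroupModel 2)) F) (R : RemFam F),
            TaylorSplitΦ (canonPTCore fun K => (p K).toCore) Φ e B R ∧
            FlatKernelCauchyΦ (AlphaInputsT3AC.dataOfV3chi p (canonPolymerCore fun K => (p K).toCore)) Φ (hF ▸ 𝔠).κ a C ∧
            KernelSizeΦ (AlphaInputsT3AC.dataOfV3chi p (canonPolymerCore fun K => (p K).toCore)) Φ (hF ▸ 𝔠).κ C_E ∧
            RemainderSmallΦ (AlphaInputsT3AC.dataOfV3chi p (canonPolymerCore fun K => (p K).toCore)) R (hF ▸ 𝔠).b₀ (hF ▸ 𝔠).p₀ (hF ▸ 𝔠).κ C_R ∧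
            CfgSizeΦ (AlphaInputsT3AC.dataOfV3chi p (canonPolymerCore fun K => (p K).toCore)) B (hF ▸ 𝔠).b₀ (hF ▸ 𝔠).p₀ C_s ∧
            CfgCauchyΦ (AlphaInputsT3AC.dataOfV3chi p (canonPolymerCore fun K => (p K).toCore)) B (hF ▸ 𝔠).b₀ (hF ▸ 𝔠).p₀ a C_B fun _ => 1

/-- The rows at the record's decay rate give the rows with the `κ`-letters (`κ := 𝔠.κ`, `kappa_record_admissible`). [folklore] -/
theorem k1aChartRowsCChi_of_KChi {L : ℕ} {𝔠 : AlphaConsts L (suGroupModel 2).N} {a₀ a₁ a : ℝ} (h : K1aChartRowsKChi L 𝔠 a₀ a₁ a) :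
    K1aChartRowsCChi L 𝔠 a₀ a₁ a := by
  obtain ⟨C, C_E, C_R, C_s, C_B, γB, hC, hCE, hCR, hCs, hCB, hγB, hall⟩ := h
  obtain ⟨hκ0, hκ₀⟩ := kappa_record_admissible 𝔠
  refine ⟨𝔠.κ, C, C_E, C_R, C_s, C_B, γB, hκ0, le_rfl, hκ₀, hC, hCE, hCR, hCs, hCB, hγB, fun F γ hF hγ hγle hγ1 hOf => ?_⟩
  subst hF
  exact hall F γ rfl hγ hγle hγ1 hOf

/-! ## §2 The registered stub 3⁗χ from the chart rows, by name -/

/-- **THE REGISTERED STUB 3⁗χ `stub_globalTwoRunSlackFamChi` FROM THE SIX CHART ROWS AT THE χ-RECORD'S CANONICAL POLYMERISATION, BY NAME**: if for every odd `L ≥ 7`, every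
constants record and [7]-constants there is a rate exponent `0 < a < 1` with `K1aChartRowsCChi L 𝔠 a₀ a₁ a`, then the text of `stub_globalTwoRunSlackFamChi` (skeleton v5kC of
stmt-QuantumFields-20520, OWNER C3 pen) holds VERBATIM — threshold `γB ⊓ gammaW L 𝔠 C_s C_B ⊓ e^{2(1−p₀)}`, `π := canonPolymerCore (toCore ∘ p)`, `σ := 7`; the five producer rows are
the core theorems `pintDecompTrivT_canonCore`, `locCover_canonCore`, `locBlockVolumeC_canonCore`, `locMatched_canonCore`, `termSizeTrivT_canonCore` at `q := toCore ∘ p`; the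
three coupling windows from `γ` small; composition `globalTwoRunSlackTail_of_chartsC`. [cite: King1986, Thm 3.4 (3.9) p.656, Prop. 3.6 p.662; Balaban1985UV3, (7) p.257, (24) p.262, (43)-(47) pp.266-267, (57) p.270] -/
theorem globalTwoRunSlackFamChi_of_k1aChartRowsCChi
    (h : ∀ (L : ℕ), Odd L → 7 ≤ L → ∀ (𝔠 : AlphaConsts L (suGroupModel 2).N) (a₀ a₁ : ℝ), 0 < a₀ → 0 < a₁ → 𝔠.B₃ * a₁ ≤ a₀ →
      ∃ a : ℝ, 0 < a ∧ a < 1 ∧ K1aChartRowsCChi L 𝔠 a₀ a₁ a) :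
    ∀ (L : ℕ), Odd L → 7 ≤ L → ∀ (𝔠 : Summit.QuantumFields.Balaban3D.Proofs.Primitives.AlphaConsts L (Summit.QuantumFields.Balaban3D.Carriers.suGroupModel 2).N)
      (a₀ a₁ : ℝ), 0 < a₀ → 0 < a₁ → 𝔠.B₃ * a₁ ≤ a₀ →
      ∃ a : ℝ, 0 < a ∧ ∃ γB : ℝ, 0 < γB ∧ ∀ (F : T3Family) (γ : ℝ) (hF : F.L = L) (hγ : 0 < γ), γ ≤ γB →
        ∀ (hγ1 : γ ≤ (min (hF ▸ 𝔠).gamma0 1) ^ 2),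
          Summit.QuantumFields.YangMills.Theorems.AlphaInputsT3AC.OfV3ChiAt F (hF ▸ 𝔠) a₀ a₁ →
          ∃ (p : ∀ K, Summit.QuantumFields.YangMills.Theorems.AlphaInputsT3AC.PkgAtV3Chi F (hF ▸ 𝔠) γ hγ hγ1 K),
            (∀ K, (p K).a₀ = a₀ ∧ (p K).a₁ = a₁) ∧
            ∃ (π : Summit.QuantumFields.YangMills.Theorems.AlphaInputsT3AC.PolymerT3 F) (σ : ℕ) (C : ℝ), 7 ≤ σ ∧ 0 ≤ C ∧
              Summit.QuantumFields.YangMills.Theorems.GlobalSlack.GlobalSupRateTSlack (Summit.QuantumFields.YangMills.Theorems.AlphaInputsT3AC.dataOfV3chi p π) (hF ▸ 𝔠).b₀ (hF ▸ 𝔠).p₀ a σ C := by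
  intro L hLo h7 𝔠 a₀ a₁ ha0 ha1 hw
  obtain ⟨a, ha, ha1', κ, C, C_E, C_R, C_s, C_B, γB, hκ0, hκle, hκ₀, hC, hCE, hCR, hCs, hCB, hγB, hall⟩ := h L hLo h7 𝔠 a₀ a₁ ha0 ha1 hw
  refine ⟨a, ha, min γB (min (gammaW L 𝔠 C_s C_B) (Real.exp (2 * (1 - 𝔠.p₀)))),
    lt_min hγB (lt_min (gammaW_pos L 𝔠 C_s C_B) (Real.exp_pos _)), fun F γ hF hγ hγle hγ1 hOf => ?_⟩
  subst hF
  have hγB' : γ ≤ γB := hγle.trans (min_le_left _ _)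
  have hW : γ ≤ gammaW F.L 𝔠 C_s C_B := hγle.trans ((min_le_right _ _).trans (min_le_left _ _))
  have hγe : Real.sqrt γ ≤ Real.exp (1 - 𝔠.p₀) := sqrt_le_exp_of_le (hγle.trans ((min_le_right _ _).trans (min_le_right _ _)))
  have h0 : γ ≤ gammaθ 𝔠.b₀ 𝔠.p₀ (1 / max 1 (C_s + C_B)) := hW.trans (min_le_left _ _)
  have h1 : γ ≤ gammaθ 𝔠.b₀ (𝔠.p₀ + 𝔠.r₀) (𝔠.ρ / (4 * max 1 𝔠.cB)) := hW.trans ((min_le_right _ _).trans (min_le_left _ _))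
  have h2 : γ ≤ gammaθ 𝔠.b₀ 𝔠.p₀ (1 / (2 * (8 * ((F.L : ℝ) + 1) ^ 2 * 𝔠.B₃ * 𝔠.Zfull))) := hW.trans ((min_le_right _ _).trans (min_le_right _ _))
  have hγ1' : γ ≤ 1 := hγ1.trans (sq_min_one_le _ 𝔠.gamma0_pos)
  obtain ⟨p, hp, Φ, e, B, R, hT, hK, hE, hR, hS, hBC⟩ := hall F γ rfl hγ hγB' hγ1 hOf
  -- the projected family of data cores
  set q : ∀ K, AlphaInputsT3AC.PkgCoreV3 F 𝔠 γ hγ hγ1 K := fun K => (p K).toCore with hq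
  have hwin : ∀ n, (C_s + C_B) * θBal F.L γ 𝔠.b₀ 𝔠.p₀ n ≤ 1 := fun n => window_sum_le_one F.hL.2.le 𝔠.b₀_pos 𝔠.p₀_pos hγ hγ1' h0 n
  have hw1 := fun K k hk => window_jet (hγ := hγ) (hγ1 := hγ1) h1 K k hk
  have hw2 := fun K k hk => window_oldSlice (hγ := hγ) (hγ1 := hγ1) h2 K k hk
  have hCT : 0 ≤ max (newConst 𝔠) (oldConst 𝔠 * (F.L : ℝ) ^ 4 * Real.exp (κ * (F.L : ℝ) ^ 3)) := le_max_of_le_left (newConst_nonneg 𝔠)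
  obtain ⟨σ, C₀, hσ, hC₀, hG⟩ := globalTwoRunSlackTail_of_chartsC (D := AlphaInputsT3AC.dataOfCoreV3 q (canonPolymerCore q))
    hγ hγ1' hγe 𝔠.b₀_pos 𝔠.p₀_pos.le ha ha1' hC hCE hCR hCs hCB hCT
    hwin (pintDecompTrivT_canonCore q) (locCover_canonCore q hκ0.le hκ₀) (locBlockVolumeC_canonCore q) (locMatched_canonCore q)
    (termSizeTrivT_canonCore q hκ0 hκle hw1 hw2) hT hK hE hR hS hBC
  exact ⟨p, hp, canonPolymerCore q, σ, C₀, hσ, hC₀, hG⟩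

/-- **THE REGISTERED STUB 3⁗χ FROM THE SIX CHART ROWS AT THE RECORD'S DECAY RATE — NO LETTER ON THE RECORD, BY NAME**
(`globalTwoRunSlackFamChi_of_k1aChartRowsCChi ∘ k1aChartRowsCChi_of_KChi`). [cite: King1986, Thm 3.4 (3.9) p.656, Prop. 3.6 p.662; Balaban1985UV3, (7) p.257, (43)-(47) pp.266-267, (57) p.270] -/
theorem globalTwoRunSlackFamChi_of_k1aChartRowsKChi
    (h : ∀ (L : ℕ), Odd L → 7 ≤ L → ∀ (𝔠 : AlphaConsts L (suGroupModel 2).N) (a₀ a₁ : ℝ), 0 < a₀ → 0 < a₁ → 𝔠.B₃ * a₁ ≤ a₀ →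
      ∃ a : ℝ, 0 < a ∧ a < 1 ∧ K1aChartRowsKChi L 𝔠 a₀ a₁ a) :
    ∀ (L : ℕ), Odd L → 7 ≤ L → ∀ (𝔠 : Summit.QuantumFields.Balaban3D.Proofs.Primitives.AlphaConsts L (Summit.QuantumFields.Balaban3D.Carriers.suGroupModel 2).N)
      (a₀ a₁ : ℝ), 0 < a₀ → 0 < a₁ → 𝔠.B₃ * a₁ ≤ a₀ →
      ∃ a : ℝ, 0 < a ∧ ∃ γB : ℝ, 0 < γB ∧ ∀ (F : T3Family) (γ : ℝ) (hF : F.L = L) (hγ : 0 < γ), γ ≤ γB →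
        ∀ (hγ1 : γ ≤ (min (hF ▸ 𝔠).gamma0 1) ^ 2),
          Summit.QuantumFields.YangMills.Theorems.AlphaInputsT3AC.OfV3ChiAt F (hF ▸ 𝔠) a₀ a₁ →
          ∃ (p : ∀ K, Summit.QuantumFields.YangMills.Theorems.AlphaInputsT3AC.PkgAtV3Chi F (hF ▸ 𝔠) γ hγ hγ1 K),
            (∀ K, (p K).a₀ = a₀ ∧ (p K).a₁ = a₁) ∧
            ∃ (π : Summit.QuantumFields.YangMills.Theorems.AlphaInputsT3AC.PolymerT3 F) (σ : ℕ) (C : ℝ), 7 ≤ σ ∧ 0 ≤ C ∧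
              Summit.QuantumFields.YangMills.Theorems.GlobalSlack.GlobalSupRateTSlack (Summit.QuantumFields.YangMills.Theorems.AlphaInputsT3AC.dataOfV3chi p π) (hF ▸ 𝔠).b₀ (hF ▸ 𝔠).p₀ a σ C :=
  globalTwoRunSlackFamChi_of_k1aChartRowsCChi fun L hLo h7 𝔠 a₀ a₁ ha0 ha1 hw => by
    obtain ⟨a, ha, ha1', hc⟩ := h L hLo h7 𝔠 a₀ a₁ ha0 ha1 hw
    exact ⟨a, ha, ha1', k1aChartRowsCChi_of_KChi hc⟩

/-! ## §3 The eleven-row K1a line at the χ-datum (free polymer parameter) -/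

/-- **THE K1a LINE AT THE χ-RECORD'S DATUM** (hypothesis schema, never asserted) — lane A's `K1aLine` (p532839) under the R-57χ token map: constants bound BEFORE the family, a
coupling threshold, and for every family / coupling / inhabited χ-package the window `(C_s + C_B)·θ(n) ≤ 1`, a coherent family `p : ∀ K, PkgAtV3Chi …`, a polymer parameter `π`, a
term function `PT`, ONE chart family, and THE ELEVEN ROWS at `D := dataOfV3chi p π`: producer side `PintDecompTrivT`, `LocCover`, `LocBlockVolume`, `LocMatched`, `TermSizeTrivT`;
chart side `TaylorSplitΦ`, K1a `FlatKernelCauchyΦ`, `KernelSizeΦ`, `RemainderSmallΦ`, `CfgSizeΦ`, `CfgCauchyΦ (ℓ ≡ 1)`. [cite: King1986, Thm 3.4 (3.9) p.656, Prop. 3.6 p.662; Balaban1985UV3, (28)-(30) p.263, (43)-(47) pp.266-267, (57) p.270] -/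
def K1aLineChi (L : ℕ) (𝔠 : AlphaConsts L (suGroupModel 2).N) (a₀ a₁ a : ℝ) : Prop :=
  ∃ (κ C C_E C_R C_s C_B C_T C' γB : ℝ), 0 ≤ C ∧ 0 ≤ C_E ∧ 0 ≤ C_R ∧ 0 ≤ C_s ∧ 0 ≤ C_B ∧ 0 ≤ C_T ∧ 0 < γB ∧
    ∀ (F : T3Family) (γ : ℝ) (hF : F.L = L) (hγ : 0 < γ), γ ≤ γB → ∀ (hγ1 : γ ≤ (min (hF ▸ 𝔠).gamma0 1) ^ 2),
      AlphaInputsT3AC.OfV3ChiAt F (hF ▸ 𝔠) a₀ a₁ →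
        (∀ n, (C_s + C_B) * θBal F.L γ (hF ▸ 𝔠).b₀ (hF ▸ 𝔠).p₀ n ≤ 1) ∧
        ∃ (p : ∀ K, AlphaInputsT3AC.PkgAtV3Chi F (hF ▸ 𝔠) γ hγ hγ1 K), (∀ K, (p K).a₀ = a₀ ∧ (p K).a₁ = a₁) ∧
          ∃ (π : AlphaInputsT3AC.PolymerT3 F) (PT : TermFn F) (Φ : ChartFam ↥(lieC (suGroupModel 2)) F) (e : VacFam F)
            (B : CfgFam ↥(lieC (suGroupModel 2)) F) (R : RemFam F),
            PintDecompTrivT (AlphaInputsT3AC.dataOfV3chi p π) PT ∧ LocCover (AlphaInputsT3AC.dataOfV3chi p π) κ C' ∧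
            LocBlockVolume (AlphaInputsT3AC.dataOfV3chi p π) ∧ LocMatched (AlphaInputsT3AC.dataOfV3chi p π) ∧
            TermSizeTrivT (AlphaInputsT3AC.dataOfV3chi p π) PT (hF ▸ 𝔠).b₀ (hF ▸ 𝔠).p₀ C_T κ ∧
            TaylorSplitΦ PT Φ e B R ∧ FlatKernelCauchyΦ (AlphaInputsT3AC.dataOfV3chi p π) Φ κ a C ∧
            KernelSizeΦ (AlphaInputsT3AC.dataOfV3chi p π) Φ κ C_E ∧
            RemainderSmallΦ (AlphaInputsT3AC.dataOfV3chi p π) R (hF ▸ 𝔠).b₀ (hF ▸ 𝔠).p₀ κ C_R ∧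
            CfgSizeΦ (AlphaInputsT3AC.dataOfV3chi p π) B (hF ▸ 𝔠).b₀ (hF ▸ 𝔠).p₀ C_s ∧
            CfgCauchyΦ (AlphaInputsT3AC.dataOfV3chi p π) B (hF ▸ 𝔠).b₀ (hF ▸ 𝔠).p₀ a C_B fun _ => 1

/-- **THE REGISTERED STUB 3⁗χ FROM THE ELEVEN-ROW K1a LINE AT THE χ-DATUM, BY NAME** (lane A's `globalTwoRunSlackFam_of_k1aLine` under the token map: threshold `γB ⊓ e^{2(1−p₀)}`,
`σ = 7`, `GlobalSlackKernelMatching.globalTwoRunSlackTail_of_charts` at `D := dataOfV3chi p π`). [cite: King1986, Thm 3.4 (3.9) p.656, Prop. 3.6 p.662; Balaban1985UV3, (43)-(47) pp.266-267, (57) p.270] -/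
theorem globalTwoRunSlackFamChi_of_k1aLineChi
    (h : ∀ (L : ℕ), Odd L → 7 ≤ L → ∀ (𝔠 : AlphaConsts L (suGroupModel 2).N) (a₀ a₁ : ℝ), 0 < a₀ → 0 < a₁ → 𝔠.B₃ * a₁ ≤ a₀ →
      ∃ a : ℝ, 0 < a ∧ a < 1 ∧ K1aLineChi L 𝔠 a₀ a₁ a) :
    ∀ (L : ℕ), Odd L → 7 ≤ L → ∀ (𝔠 : Summit.QuantumFields.Balaban3D.Proofs.Primitives.AlphaConsts L (Summit.QuantumFields.Balaban3D.Carriers.suGroupModel 2).N)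
      (a₀ a₁ : ℝ), 0 < a₀ → 0 < a₁ → 𝔠.B₃ * a₁ ≤ a₀ →
      ∃ a : ℝ, 0 < a ∧ ∃ γB : ℝ, 0 < γB ∧ ∀ (F : T3Family) (γ : ℝ) (hF : F.L = L) (hγ : 0 < γ), γ ≤ γB →
        ∀ (hγ1 : γ ≤ (min (hF ▸ 𝔠).gamma0 1) ^ 2),
          Summit.QuantumFields.YangMills.Theorems.AlphaInputsT3AC.OfV3ChiAt F (hF ▸ 𝔠) a₀ a₁ →
          ∃ (p : ∀ K, Summit.QuantumFields.YangMills.Theorems.AlphaInputsT3AC.PkgAtV3Chi F (hF ▸ 𝔠) γ hγ hγ1 K),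
            (∀ K, (p K).a₀ = a₀ ∧ (p K).a₁ = a₁) ∧
            ∃ (π : Summit.QuantumFields.YangMills.Theorems.AlphaInputsT3AC.PolymerT3 F) (σ : ℕ) (C : ℝ), 7 ≤ σ ∧ 0 ≤ C ∧
              Summit.QuantumFields.YangMills.Theorems.GlobalSlack.GlobalSupRateTSlack (Summit.QuantumFields.YangMills.Theorems.AlphaInputsT3AC.dataOfV3chi p π) (hF ▸ 𝔠).b₀ (hF ▸ 𝔠).p₀ a σ C := by
  intro L hLo h7 𝔠 a₀ a₁ ha0 ha1 hw
  obtain ⟨a, ha, ha1', κ, C, C_E, C_R, C_s, C_B, C_T, C', γB, hC, hCE, hCR, hCs, hCB, hCT, hγB, hline⟩ := h L hLo h7 𝔠 a₀ a₁ ha0 ha1 hw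
  refine ⟨a, ha, min γB (Real.exp (2 * (1 - 𝔠.p₀))), lt_min hγB (Real.exp_pos _), fun F γ hF hγ hγle hγ1 hOf => ?_⟩
  subst hF
  have hγB' : γ ≤ γB := hγle.trans (min_le_left _ _)
  have hγe : Real.sqrt γ ≤ Real.exp (1 - 𝔠.p₀) := sqrt_le_exp_of_le (hγle.trans (min_le_right _ _))
  have hγ1' : γ ≤ 1 := hγ1.trans (sq_min_one_le _ 𝔠.gamma0_pos)
  obtain ⟨hwin, p, hp, π, PT, Φ, e, B, R, hdec, hLC, hBV, hLM, hTS, hT, hK, hE, hR, hS, hBC⟩ := hline F γ rfl hγ hγB' hγ1 hOf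
  obtain ⟨σ, C₀, hσ, hC₀, hG⟩ := globalTwoRunSlackTail_of_charts hγ hγ1' hγe 𝔠.b₀_pos 𝔠.p₀_pos.le ha ha1' hC hCE hCR hCs hCB hCT
    hwin hdec hLC hBV hLM hTS hT hK hE hR hS hBC
  exact ⟨p, hp, π, σ, C₀, hσ, hC₀, hG⟩

end Summit.QuantumFields.YangMills.Theorems.GlobalSlackCanonicalPolymers

end
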